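import Mathlib
import HarnessLib
import Summits.NavierStokesRegularity.NavierStokesRegularity.Theorems.UnthreadedDoorNetFluxEnvelopeDefs

/-!
# Route `UnthreadedDoor`, crux `PoloidalLiouville` (stmt-NavierStokesRegularity-1222), WALL W1 `stub_scalarLiouville` —
# crux idea «netflux-typei-gap» (ns-idea-14), stub NF-1b `SupEnvelopeLaw`: THE ENVELOPE TOOLKIT (session 1 of a multi-session build)

KEY-NS #156 (director-ns g16; author ns-idea-14; critic of record ns-wall-crit-1): the elementary structure of the spherical
sup-envelope `F(t,r) = r · max_{S_r(x₀)} T(t)` of a scalar `T` smooth on `]t₀,0[ × (ℝ³ ∖ {x₀})` — the objects of NF-1b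
(`SupEnvelopeLaw`: `(∂_t − ∂_r²) F ≤ r · supEnvDefect` in `𝒟′`), whose proof (Danskin + semiconvexity + Alexandrov / Stieltjes
integration by parts) is the NEXT session's item.  This file: compactness / attainment of the spherical argmax, the value of the
envelope at a maximiser, the unit-sphere reparametrisation `S_r(x₀) = x₀ + r·S²`, joint continuity of `(t,r) ↦ max_{S_r(x₀)} T(t)`
(`IsCompact.continuous_sSup` over the FIXED compact parameter set `S²`), Danskin's identity at points of differentiability
(touching from below + Fermat), and attainment of the envelope defect `supEnvDefect` (an `sInf` over the compact argmax).

* `sphere_eq_image_unitSphere`, `image_sphere_eq_image_unitSphere` — `S_r(x₀) = (x₀ + r • ·) '' S²` for `r > 0`;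
* `ne_center_of_mem_sphere`, `center_add_smul_ne` — points of `S_r(x₀)`, `r > 0`, are not the centre;
* `continuousOn_sphere_of_continuousOn_compl` — a function continuous off `x₀` is continuous on every `S_r(x₀)`, `r > 0`;
* `bddAbove_image_sphere`, `le_sphSup`, `exists_mem_sphArgmax`, `sphArgmax_subset_sphere`, `sphSup_eq_of_mem_sphArgmax`,
  `exists_eq_sphSup`, `mem_sphArgmax_iff`, `isCompact_sphArgmax` — the argmax is a nonempty compact subset of the sphere on which `f = sphSup`;
* `continuousOn_sphSup_family` — `(t,r) ↦ sphSup (T t) x₀ r` is continuous on `]t₀,0[ × ]0,∞[`;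
* `fderiv_eq_of_touching_below`, `deriv_eq_of_touching_below` — DANSKIN AT DIFFERENTIABILITY POINTS: if `G ≤ F` near `p`,
  `G p = F p` and both are differentiable at `p`, their derivatives agree (Fermat for the local minimum of `F − G`);
* `rsphSup_ge_slice`, `rsphSup_eq_slice_of_mem_sphArgmax` — the envelope `F` dominates every slice `r ↦ r·T(t, x₀ + r ξ)` and
  touches it at maximisers (the input of Danskin);
* `exists_mem_sphArgmax_sInf_eq`, `exists_mem_sphArgmax_eq_supEnvDefect` — an `sInf` over the argmax (in particular the one
  defining `supEnvDefect`) is attained at a maximiser, for data continuous off the centre.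

WHAT THIS IS NOT: no NS-regularity statement is touched; NF-1b is NOT proved here; `PoloidalLiouville` (1222), W1, the line's rung
target `UnimodalScalarLiouvilleTypeI` and the summit stay OPEN.  `--supports stmt-NavierStokesRegularity-1222 --as helper`.
[folklore]
-/

noncomputable section

-- the summit and its single sub-problem share the name (CONVENTIONS §1)
set_option linter.dupNamespace false

open Set Function Filter Topology InnerProductSpace MeasureTheory
open scoped RealInnerProductSpace ContDiff

namespace Summit.NavierStokesRegularity.NavierStokesRegularity.Theorems.PoloidalLiouville.NetFlux

open Literature.Analysis Literature.Analysis.FluidPDE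

/-! ### The unit-sphere reparametrisation of `S_r(x₀)` -/

/-- `S_r(x₀) = x₀ + r · S²` for `r > 0`. [folklore] -/
theorem sphere_eq_image_unitSphere (x₀ : E3) {r : ℝ} (hr : 0 < r) :
    Metric.sphere x₀ r = (fun ξ : E3 => x₀ + r • ξ) '' Metric.sphere (0 : E3) 1 := by
  ext x
  simp only [mem_sphere_iff_norm, sub_zero, mem_image]
  constructor
  · intro hx
    refine ⟨r⁻¹ • (x - x₀), ?_, ?_⟩
    · rw [norm_smul, norm_inv, Real.norm_of_nonneg hr.le, hx, inv_mul_cancel₀ hr.ne']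
    · rw [smul_smul, mul_inv_cancel₀ hr.ne', one_smul, add_sub_cancel]
  · rintro ⟨ξ, hξ, rfl⟩
    rw [add_sub_cancel_left, norm_smul, Real.norm_of_nonneg hr.le, hξ, mul_one]

/-- `f(S_r(x₀)) = (ξ ↦ f(x₀ + r ξ))(S²)` for `r > 0`. [folklore] -/
theorem image_sphere_eq_image_unitSphere (f : E3 → ℝ) (x₀ : E3) {r : ℝ} (hr : 0 < r) :
    f '' Metric.sphere x₀ r = (fun ξ : E3 => f (x₀ + r • ξ)) '' Metric.sphere (0 : E3) 1 := by
  rw [sphere_eq_image_unitSphere x₀ hr, Set.image_image]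

/-- A point of `S_r(x₀)`, `r > 0`, is not the centre. [folklore] -/
theorem ne_center_of_mem_sphere {x₀ x : E3} {r : ℝ} (hr : 0 < r) (hx : x ∈ Metric.sphere x₀ r) : x ≠ x₀ := by
  intro h
  rw [mem_sphere_iff_norm, h, sub_self, norm_zero] at hx
  exact hr.ne' hx.symm

/-- `x₀ + r ξ ≠ x₀` for `r > 0`, `ξ ∈ S²`. [folklore] -/
theorem center_add_smul_ne {x₀ ξ : E3} {r : ℝ} (hr : 0 < r) (hξ : ξ ∈ Metric.sphere (0 : E3) 1) : x₀ + r • ξ ≠ x₀ := by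
  intro h
  rw [add_eq_left, smul_eq_zero] at h
  rcases h with h | h
  · exact hr.ne' h
  · rw [mem_sphere_iff_norm, sub_zero, h, norm_zero] at hξ
    exact zero_ne_one hξ

/-- A function continuous off `x₀` is continuous on every sphere `S_r(x₀)`, `r > 0`. [folklore] -/
theorem continuousOn_sphere_of_continuousOn_compl {f : E3 → ℝ} {x₀ : E3} (hf : ContinuousOn f ({x₀}ᶜ)) {r : ℝ}
    (hr : 0 < r) : ContinuousOn f (Metric.sphere x₀ r) :=
  hf.mono fun _ hx => ne_center_of_mem_sphere hr hx

/-! ### The spherical argmax: nonempty, compact, carries the value `sphSup` -/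

variable {f : E3 → ℝ} {x₀ : E3} {r : ℝ}

/-- The image of a sphere under a function continuous on it is bounded above. [folklore] -/
theorem bddAbove_image_sphere (hf : ContinuousOn f (Metric.sphere x₀ r)) : BddAbove (f '' Metric.sphere x₀ r) :=
  (isCompact_sphere x₀ r).bddAbove_image hf

/-- `f y ≤ max_{S_r(x₀)} f` for `y ∈ S_r(x₀)`. [folklore] -/
theorem le_sphSup (hf : ContinuousOn f (Metric.sphere x₀ r)) {y : E3} (hy : y ∈ Metric.sphere x₀ r) :
    f y ≤ sphSup f x₀ r :=
  le_csSup (bddAbove_image_sphere hf) ⟨y, hy, rfl⟩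

/-- The argmax is a subset of the sphere. [folklore] -/
theorem sphArgmax_subset_sphere (f : E3 → ℝ) (x₀ : E3) (r : ℝ) : sphArgmax f x₀ r ⊆ Metric.sphere x₀ r :=
  fun _ hx => hx.1

/-- **The spherical maximum is attained**: `argmax_{S_r(x₀)} f ≠ ∅` for `r ≥ 0` and `f` continuous on the sphere. [folklore] -/
theorem exists_mem_sphArgmax (hf : ContinuousOn f (Metric.sphere x₀ r)) (hr : 0 ≤ r) : (sphArgmax f x₀ r).Nonempty := by
  obtain ⟨x, hx, hmax⟩ := (isCompact_sphere x₀ r).exists_isMaxOn (NormedSpace.sphere_nonempty.2 hr) hf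
  exact ⟨x, hx, fun y hy => hmax hy⟩

/-- At a maximiser, `max_{S_r(x₀)} f = f x`. [folklore] -/
theorem sphSup_eq_of_mem_sphArgmax (hf : ContinuousOn f (Metric.sphere x₀ r)) {x : E3} (hx : x ∈ sphArgmax f x₀ r) :
    sphSup f x₀ r = f x := by
  refine le_antisymm (csSup_le ⟨f x, x, hx.1, rfl⟩ ?_) (le_sphSup hf hx.1)
  rintro _ ⟨y, hy, rfl⟩
  exact hx.2 y hy

/-- **Attainment of `sphSup`**: `∃ x ∈ S_r(x₀)`, `f x = max_{S_r(x₀)} f`. [folklore] -/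
theorem exists_eq_sphSup (hf : ContinuousOn f (Metric.sphere x₀ r)) (hr : 0 ≤ r) :
    ∃ x ∈ Metric.sphere x₀ r, f x = sphSup f x₀ r := by
  obtain ⟨x, hx⟩ := exists_mem_sphArgmax hf hr
  exact ⟨x, hx.1, (sphSup_eq_of_mem_sphArgmax hf hx).symm⟩

/-- Membership in the argmax: `x ∈ S_r(x₀)` and `max_{S_r(x₀)} f ≤ f x`. [folklore] -/
theorem mem_sphArgmax_iff (hf : ContinuousOn f (Metric.sphere x₀ r)) {x : E3} :
    x ∈ sphArgmax f x₀ r ↔ x ∈ Metric.sphere x₀ r ∧ sphSup f x₀ r ≤ f x := by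
  constructor
  · intro hx
    exact ⟨hx.1, (sphSup_eq_of_mem_sphArgmax hf hx).le⟩
  · rintro ⟨hx, hle⟩
    exact ⟨hx, fun y hy => (le_sphSup hf hy).trans hle⟩

/-- **The argmax is compact**: it is the closed subset `S_r(x₀) ∩ {f ≥ max}` of the compact sphere. [folklore] -/
theorem isCompact_sphArgmax (hf : ContinuousOn f (Metric.sphere x₀ r)) : IsCompact (sphArgmax f x₀ r) := by
  have heq : sphArgmax f x₀ r = Metric.sphere x₀ r ∩ f ⁻¹' Ici (sphSup f x₀ r) := by
    ext x
    rw [mem_sphArgmax_iff hf]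
    rfl
  rw [heq]
  exact (isCompact_sphere x₀ r).of_isClosed_subset
    (hf.preimage_isClosed_of_isClosed Metric.isClosed_sphere isClosed_Ici) inter_subset_left

/-! ### Joint continuity of `(t, r) ↦ max_{S_r(x₀)} T(t)` -/

/-- **The spherical maximum of a jointly continuous family is jointly continuous in `(t, r)`** on `]t₀,0[ × ]0,∞[`:
after the reparametrisation `S_r(x₀) = x₀ + r S²` it is the `sSup` over the fixed compact `S²` of a function jointly continuous in
`((t,r), ξ)` (`IsCompact.continuous_sSup`).  Only continuity of `T` off the centre is used. [folklore] -/
theorem continuousOn_sphSup_family {T : ℝ → E3 → ℝ} {x₀ : E3} {t₀ : ℝ}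
    (hT : ContinuousOn (uncurry T) (Ioo t₀ 0 ×ˢ ({x₀}ᶜ : Set E3))) :
    ContinuousOn (fun p : ℝ × ℝ => sphSup (T p.1) x₀ p.2) (Ioo t₀ 0 ×ˢ Ioi 0) := by
  set D : Set (ℝ × ℝ) := Ioo t₀ 0 ×ˢ Ioi 0 with hD
  -- the family on the parameter subtype, indexed by the unit sphere subtype
  set g : D → Metric.sphere (0 : E3) 1 → ℝ := fun p ξ => T p.1.1 (x₀ + p.1.2 • (ξ : E3)) with hg
  have hgc : Continuous ↿g := by
    have hA : Continuous fun q : D × Metric.sphere (0 : E3) 1 =>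
        ((q.1.1.1, x₀ + q.1.1.2 • (q.2 : E3)) : ℝ × E3) :=
      (continuous_fst.comp (continuous_subtype_val.comp continuous_fst)).prodMk
        (continuous_const.add ((continuous_snd.comp (continuous_subtype_val.comp continuous_fst)).smul
          (continuous_subtype_val.comp continuous_snd)))
    refine hT.comp_continuous hA fun q => ⟨q.1.2.1, ?_⟩
    exact center_add_smul_ne q.1.2.2 q.2.2
  have hc : Continuous fun p : D => sSup (g p '' univ) := isCompact_univ.continuous_sSup hgc
  -- identify the values
  have hval : ∀ p : D, sSup (g p '' univ) = sphSup (T p.1.1) x₀ p.1.2 := by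
    intro p
    have e : g p '' univ = T p.1.1 '' Metric.sphere x₀ p.1.2 := by
      rw [image_univ, image_sphere_eq_image_unitSphere (T p.1.1) x₀ p.2.2, Set.image_eq_range]
    rw [e]
    rfl
  rw [continuousOn_iff_continuous_restrict]
  have e : D.restrict (fun p : ℝ × ℝ => sphSup (T p.1) x₀ p.2) = fun p : D => sSup (g p '' univ) := by
    funext p; rw [hval]; rfl
  rw [e]
  exact hc

/-! ### Danskin at points of differentiability: touching from below -/

section Touching

variable {E : Type*} [NormedAddCommGroup E] [NormedSpace ℝ E]

/-- **Touching from below forces equal derivatives** (the pointwise form of Danskin's theorem): if `G ≤ F` near `p`,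
`G p = F p`, and both are differentiable at `p`, then `DF(p) = DG(p)` — `F − G ≥ 0` has a local minimum at `p`
(Fermat, `IsLocalMin.fderiv_eq_zero`). [folklore] -/
theorem fderiv_eq_of_touching_below {F G : E → ℝ} {p : E} (hle : ∀ᶠ q in 𝓝 p, G q ≤ F q) (heq : G p = F p)
    (hF : DifferentiableAt ℝ F p) (hG : DifferentiableAt ℝ G p) : fderiv ℝ F p = fderiv ℝ G p := by
  have hmin : IsLocalMin (fun q => F q - G q) p := by
    filter_upwards [hle] with q hq
    rw [← heq, sub_self]
    exact sub_nonneg.2 hq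
  have h := hmin.fderiv_eq_zero
  rw [fderiv_fun_sub hF hG] at h
  exact sub_eq_zero.1 h

/-- One-variable form: `G ≤ F` near `a`, `G a = F a`, both differentiable at `a` ⇒ `F'(a) = G'(a)`. [folklore] -/
theorem deriv_eq_of_touching_below {F G : ℝ → ℝ} {a : ℝ} (hle : ∀ᶠ b in 𝓝 a, G b ≤ F b) (heq : G a = F a)
    (hF : DifferentiableAt ℝ F a) (hG : DifferentiableAt ℝ G a) : deriv F a = deriv G a := by
  have h := fderiv_eq_of_touching_below hle heq hF hG
  rw [← fderiv_apply_one_eq_deriv, ← fderiv_apply_one_eq_deriv, h]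

end Touching

/-! ### The envelope `F(t,r) = r · max_{S_r(x₀)} T(t)` versus its slices `r · T(t, x₀ + r ξ)` -/

/-- **The envelope dominates every slice**: `r · T(t, x₀ + r ξ) ≤ r · max_{S_r(x₀)} T(t)` for `ξ ∈ S²`, `r > 0`. [folklore] -/
theorem rsphSup_ge_slice {T : ℝ → E3 → ℝ} {x₀ : E3} {t r : ℝ} (hr : 0 < r)
    (hf : ContinuousOn (T t) (Metric.sphere x₀ r)) {ξ : E3} (hξ : ξ ∈ Metric.sphere (0 : E3) 1) :
    r * T t (x₀ + r • ξ) ≤ r * sphSup (T t) x₀ r := by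
  refine mul_le_mul_of_nonneg_left (le_sphSup hf ?_) hr.le
  rw [sphere_eq_image_unitSphere x₀ hr]
  exact ⟨ξ, hξ, rfl⟩

/-- **The envelope touches the slice through a maximiser**: if `x₀ + r ξ ∈ argmax_{S_r(x₀)} T(t)` then
`r · max_{S_r(x₀)} T(t) = r · T(t, x₀ + r ξ)`. [folklore] -/
theorem rsphSup_eq_slice_of_mem_sphArgmax {T : ℝ → E3 → ℝ} {x₀ : E3} {t r : ℝ}
    (hf : ContinuousOn (T t) (Metric.sphere x₀ r)) {ξ : E3} (hξ : x₀ + r • ξ ∈ sphArgmax (T t) x₀ r) :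
    r * sphSup (T t) x₀ r = r * T t (x₀ + r • ξ) := by
  rw [sphSup_eq_of_mem_sphArgmax hf hξ]

/-! ### Infima over the argmax are attained -/

/-- **An `sInf` over the spherical argmax is attained**: for `r > 0`, `f` continuous off `x₀` and `g` continuous off `x₀`, there
is a maximiser `x ∈ argmax_{S_r(x₀)} f` with `sInf (g '' argmax) = g x`, and `sInf (g '' argmax) ≤ g x'` for every maximiser `x'`
(the argmax is a nonempty compact subset of `ℝ³ ∖ {x₀}`). [folklore] -/
theorem exists_mem_sphArgmax_sInf_eq {f g : E3 → ℝ} {x₀ : E3} {r : ℝ} (hr : 0 < r) (hf : ContinuousOn f ({x₀}ᶜ))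
    (hg : ContinuousOn g ({x₀}ᶜ)) :
    (∃ x ∈ sphArgmax f x₀ r, sInf (g '' sphArgmax f x₀ r) = g x) ∧
    (∀ x ∈ sphArgmax f x₀ r, sInf (g '' sphArgmax f x₀ r) ≤ g x) ∧ BddBelow (g '' sphArgmax f x₀ r) := by
  have hfS : ContinuousOn f (Metric.sphere x₀ r) := continuousOn_sphere_of_continuousOn_compl hf hr
  have hK : IsCompact (sphArgmax f x₀ r) := isCompact_sphArgmax hfS
  have hne : (sphArgmax f x₀ r).Nonempty := exists_mem_sphArgmax hfS hr.le
  have hgK : ContinuousOn g (sphArgmax f x₀ r) := hg.mono fun x hx => ne_center_of_mem_sphere hr hx.1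
  have hbdd : BddBelow (g '' sphArgmax f x₀ r) := hK.bddBelow_image hgK
  refine ⟨?_, fun x hx => csInf_le hbdd ⟨x, hx, rfl⟩, hbdd⟩
  obtain ⟨x, hx, hmin⟩ := hK.exists_isMinOn hne hgK
  refine ⟨x, hx, le_antisymm (csInf_le hbdd ⟨x, hx, rfl⟩) (le_csInf (hne.image _) ?_)⟩
  rintro _ ⟨y, hy, rfl⟩
  exact hmin hy

/-! ### The envelope defect is attained -/

/-- **The `sInf` defining `supEnvDefect` is attained at a maximiser**: for `r > 0`, `T(t,·)` continuous off `x₀` and the radial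
heat defect `d(x) = ∂ₜT(t,x) − ∂_r²T(t,x) − (2/r)∂_rT(t,x)` continuous off `x₀`, there is `x⁺ ∈ argmax_{S_r(x₀)} T(t)` with
`supEnvDefect T x₀ t r = d(x⁺)`, and `supEnvDefect T x₀ t r ≤ d(x)` for every maximiser `x`. [folklore] -/
theorem exists_mem_sphArgmax_eq_supEnvDefect {T : ℝ → E3 → ℝ} {x₀ : E3} {t r : ℝ} (hr : 0 < r)
    (hf : ContinuousOn (T t) ({x₀}ᶜ))
    (hd : ContinuousOn (fun x => deriv (fun s => T s x) t - radDeriv2 (T t) x₀ x - (2 / r) * radDeriv (T t) x₀ x) ({x₀}ᶜ)) :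
    (∃ x ∈ sphArgmax (T t) x₀ r,
      supEnvDefect T x₀ t r = deriv (fun s => T s x) t - radDeriv2 (T t) x₀ x - (2 / r) * radDeriv (T t) x₀ x) ∧
    ∀ x ∈ sphArgmax (T t) x₀ r,
      supEnvDefect T x₀ t r ≤ deriv (fun s => T s x) t - radDeriv2 (T t) x₀ x - (2 / r) * radDeriv (T t) x₀ x := by
  obtain ⟨h1, h2, -⟩ := exists_mem_sphArgmax_sInf_eq hr hf hd
  exact ⟨h1, h2⟩

end Summit.NavierStokesRegularity.NavierStokesRegularity.Theorems.PoloidalLiouville.NetFlux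

end
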